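import Mathlib
import HarnessLib
import Summits.HubbardSuperconductivity.HubbardSuperconductivity.Theorems.KLProgrammeKLRegimeCountertermLatticeAngleNet

/-!
# Route `KLProgramme`, crux K3 (stmt-HubbardSuperconductivity-19937) — «THE NEAREST LATTICE SITE OF A (FRAME-)CURVE POINT IS IN THE FLAT TUBE»:
# every momentum `q` of the open square with margin `2π/L` from the seam has a torus site whose centred momentum is within `π/L` of `q`
# (sup metric), and if `q` lies on the curve `{ε = μ + κ}` that site has `|ξ_μ| ≤ 4π/L + |κ|`

Cell gate-hubbard-kl, seat p1b (g4).  Step (2) of the child-2 closing route under the Δ18 repair (child `KLRegimeCountertermV9/V10`,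
stmt-…-19664; k3c3-p3 2026-08-26 18:20Z «YES PLEASE»): to kill the off-lattice wiggle `K*(k_F θ) − K*(p_k)` child 2 reads `K*` at the
lattice site NEAREST to the frame's curve point `k_F(θ)` and needs that site inside the flat tube (`χ_flat = 1`, i.e. `|ξ_μ| ≤ klFlatR`).
On k3c3-p3's grid tools (`torusCentredMomentum_intCast`, `abs_nambuXi_le_of_near`, `…CountertermLatticeAngleNet`):
* `abs_le_pi_sub_sqrt_of_eps2_le` — a point of the closed square with `ε₀(q) ≤ −η` (`0 < η`) is at sup-distance `≥ √η` from the seam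
  `|qᵢ| = π` (`cos x ≥ 1 − x²/2`); on `klWindowC` frames' curves `ε₀ = μ + K ≤ −0.15 + |K|`;
* `exists_site_near` — `|qᵢ| ≤ π − 2π/L` (`L ≥ 4`) ⇒ ∃ site `k` with `|torusCentredMomentum L k i − q i| ≤ π/L` for both `i` (round `qᵢL/2π`);
* **`exists_site_near_levelPoint`** — if moreover `ε₀(q) = μ + κ` then that site has `|nambuXi L μ k| ≤ 4·(π/L) + |κ|`; so for
  `|κ| ≤ klFlatR/2` and `L ≥ 8π/klFlatR = 160π` it is a flat-tube site (`_flatTube` form: `|nambuXi L μ k| ≤ klFlatR`).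
Proofs only; nothing is asserted about the model.
-/

noncomputable section

namespace Summit.HubbardSuperconductivity.HubbardSuperconductivity.Theorems.KLRegimeSplit

set_option linter.dupNamespace false -- summit = problem name (single-conjunct summit), D-0017

open Real Set
open Literature.MathematicalPhysics.QuantumLattice Literature.Probability.LatticeModels
open Literature.MathematicalPhysics.QuantumLattice.BandSectorCounting

/-! ## §1 Points of a sub-level set of the free band stay away from the seam -/

/-- If `|x| ≤ π` and `cos x ≥ −1 + η/2` with `0 < η`, then `|x| ≤ π − √η`. -/
theorem abs_le_pi_sub_sqrt_of_cos_ge {x η : ℝ} (hx : |x| ≤ π) (hcos : -1 + η / 2 ≤ Real.cos x) :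
    |x| ≤ π - Real.sqrt η := by
  -- `cos x = -cos(π - |x|)` and `cos(π - |x|) ≥ 1 - (π - |x|)²/2`
  have hcx : Real.cos x = Real.cos |x| := by
    rcases abs_choice x with h | h
    · rw [h]
    · rw [h, Real.cos_neg]
  have h1 : Real.cos (π - |x|) = -Real.cos x := by rw [Real.cos_pi_sub, hcx]
  have h2 : 1 - (π - |x|) ^ 2 / 2 ≤ Real.cos (π - |x|) := Real.one_sub_sq_div_two_le_cos
  have h3 : η ≤ (π - |x|) ^ 2 := by linarith
  have h4 : 0 ≤ π - |x| := by linarith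
  have h5 : Real.sqrt η ≤ π - |x| := by
    rw [← Real.sqrt_sq h4]
    exact Real.sqrt_le_sqrt h3
  linarith

/-- **Points with `ε₀ ≤ −η` are `√η`-far from the seam**: `|qᵢ| ≤ π` (both `i`), `ε₀(q) = −2(cos q₀ + cos q₁) ≤ −η`, `0 < η` ⇒
`|q₀|, |q₁| ≤ π − √η`. -/
theorem abs_le_pi_sub_sqrt_of_eps2_le {q : Fin 2 → ℝ} {η : ℝ} (hq : ∀ i, |q i| ≤ π)
    (hε : eps2 (q 0) (q 1) ≤ -η) : ∀ i, |q i| ≤ π - Real.sqrt η := by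
  have hc0 : Real.cos (q 0) ≤ 1 := Real.cos_le_one _
  have hc1 : Real.cos (q 1) ≤ 1 := Real.cos_le_one _
  unfold eps2 at hε
  intro i
  fin_cases i
  · exact abs_le_pi_sub_sqrt_of_cos_ge (hq 0) (by simp; linarith)
  · exact abs_le_pi_sub_sqrt_of_cos_ge (hq 1) (by simp; linarith)

/-! ## §2 The nearest torus site -/

section Grid

variable (L : ℕ) [NeZero L]

/-- **Every point of the square with margin `2π/L` from the seam has a torus site within `π/L`** (sup metric, centred momenta). -/
theorem exists_site_near {q : Fin 2 → ℝ} (hq : ∀ i, |q i| ≤ π - 2 * π / L) :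
    ∃ k : TorusSite 2 L, ∀ i, |torusCentredMomentum L k i - q i| ≤ π / L := by
  have hL : (0 : ℝ) < L := Nat.cast_pos.2 (Nat.pos_of_ne_zero (NeZero.ne L))
  have hpi : 0 < π := Real.pi_pos
  -- round each coordinate to the grid `2πℤ/L`
  set t : Fin 2 → ℤ := fun i => round (q i * L / (2 * π)) with ht
  have hround : ∀ i, |(t i : ℝ) - q i * L / (2 * π)| ≤ 1 / 2 := fun i => by
    rw [ht, abs_sub_comm]; exact abs_sub_round _
  have hsmall : ∀ i, |((t i : ℤ) : ℝ)| < L / 2 := by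
    intro i
    have h1 : |(t i : ℝ)| ≤ |q i * L / (2 * π)| + 1 / 2 := by
      have := abs_sub_abs_le_abs_sub (t i : ℝ) (q i * L / (2 * π))
      linarith [hround i]
    have h2 : |q i * L / (2 * π)| ≤ (π - 2 * π / L) * L / (2 * π) := by
      rw [abs_div, abs_mul, abs_of_pos hL, abs_of_pos (by positivity : (0 : ℝ) < 2 * π)]
      exact div_le_div_of_nonneg_right (mul_le_mul_of_nonneg_right (hq i) hL.le) (by positivity)
    have h3 : (π - 2 * π / L) * L / (2 * π) = L / 2 - 1 := by field_simp
    linarith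
  refine ⟨fun i => ((t i : ℤ) : ZMod L), fun i => ?_⟩
  rw [torusCentredMomentum_intCast L hsmall]
  have e : 2 * π / L * ((t i : ℤ) : ℝ) - q i = (2 * π / L) * ((t i : ℝ) - q i * L / (2 * π)) := by
    field_simp
  rw [e, abs_mul, abs_of_pos (by positivity : (0 : ℝ) < 2 * π / L)]
  calc 2 * π / L * |(t i : ℝ) - q i * L / (2 * π)| ≤ 2 * π / L * (1 / 2) :=
        mul_le_mul_of_nonneg_left (hround i) (by positivity)
    _ = π / L := by ring

/-- **The nearest site of a point of the level curve `{ε₀ = μ + κ}` is `(4π/L + |κ|)`-close to the free Fermi curve in energy**: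
`|nambuXi L μ k| ≤ 4·(π/L) + |κ|`. -/
theorem exists_site_near_levelPoint {q : Fin 2 → ℝ} (hq : ∀ i, |q i| ≤ π - 2 * π / L) {μ κ : ℝ}
    (hε : eps2 (q 0) (q 1) = μ + κ) :
    ∃ k : TorusSite 2 L, (∀ i, |torusCentredMomentum L k i - q i| ≤ π / L) ∧ |nambuXi L μ k| ≤ 4 * (π / L) + |κ| := by
  obtain ⟨k, hk⟩ := exists_site_near L hq
  refine ⟨k, hk, ?_⟩
  have h := abs_nambuXi_le_of_near L hε hk
  -- `ξ_μ = ξ_{μ+κ} + κ`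
  have e : nambuXi L μ k = nambuXi L (μ + κ) k + κ := by unfold nambuXi; ring
  rw [e]
  exact (abs_add_le _ _).trans (by linarith)

/-- **Flat-tube form**: for `|κ| ≤ klFlatR/2` and `8π/klFlatR ≤ L` (i.e. `L ≥ 160π`), the nearest site of a point of `{ε₀ = μ + κ}`
(with the seam margin) satisfies `|nambuXi L μ k| ≤ klFlatR` — it lies where the flat cutoff equals `1`. -/
theorem exists_site_near_levelPoint_flatTube {q : Fin 2 → ℝ} (hq : ∀ i, |q i| ≤ π - 2 * π / L) {μ κ : ℝ}
    (hε : eps2 (q 0) (q 1) = μ + κ) (hκ : |κ| ≤ klFlatR / 2) (hL : 8 * π / klFlatR ≤ L) :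
    ∃ k : TorusSite 2 L, (∀ i, |torusCentredMomentum L k i - q i| ≤ π / L) ∧ |nambuXi L μ k| ≤ klFlatR := by
  obtain ⟨k, hk, hξ⟩ := exists_site_near_levelPoint L hq hε
  refine ⟨k, hk, hξ.trans ?_⟩
  have hR : (0 : ℝ) < klFlatR := by unfold klFlatR; norm_num
  have hLpos : (0 : ℝ) < L := Nat.cast_pos.2 (Nat.pos_of_ne_zero (NeZero.ne L))
  have h1 : 4 * (π / L) ≤ klFlatR / 2 := by
    rw [div_le_iff₀ hR] at hL
    rw [show 4 * (π / L) = 4 * π / L by ring, div_le_iff₀ hLpos]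
    linarith
  linarith

omit [NeZero L] in
/-- **Seam margin for curve points on the covariance window**: if `|qᵢ| ≤ π`, `ε₀(q) = μ + κ` with `μ ≤ −0.15` and `|κ| ≤ 1/20`, then
`|qᵢ| ≤ π − 2π/L` as soon as `L ≥ 20` (`ε₀ ≤ −1/10`, margin `√(1/10) > 0.316 ≥ 2π/20`). -/
theorem seamMargin_of_levelPoint {q : Fin 2 → ℝ} (hq : ∀ i, |q i| ≤ π) {μ κ : ℝ} (hε : eps2 (q 0) (q 1) = μ + κ)
    (hμ : μ ≤ -0.15) (hκ : |κ| ≤ 1 / 20) (hL : (20 : ℝ) ≤ L) : ∀ i, |q i| ≤ π - 2 * π / L := by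
  have hκ' := (abs_le.1 hκ).2
  have hle : eps2 (q 0) (q 1) ≤ -(1 / 10) := by rw [hε]; linarith
  have hmar := abs_le_pi_sub_sqrt_of_eps2_le hq hle
  have hsqrt : 2 * π / L ≤ Real.sqrt (1 / 10) := by
    have hLpos : (0 : ℝ) < L := by linarith
    have h1 : 2 * π / L ≤ 2 * π / 20 := div_le_div_of_nonneg_left (by positivity) (by norm_num) hL
    have h2 : 2 * π / 20 ≤ 0.316 := by
      have := Real.pi_lt_d2  -- π < 3.15
      rw [div_le_iff₀ (by norm_num : (0 : ℝ) < 20)]; linarith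
    have h3 : (0.316 : ℝ) ≤ Real.sqrt (1 / 10) := by
      rw [Real.le_sqrt (by norm_num) (by norm_num)]; norm_num
    linarith
  intro i
  linarith [hmar i]

end Grid

end Summit.HubbardSuperconductivity.HubbardSuperconductivity.Theorems.KLRegimeSplit

end
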